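import Summits.QuantumFields.YangMills.Theses.ForcedResponseSkewness
import Summits.QuantumFields.YangMills.Theorems.ForcedResponseSkewnessResponseLocalisationSmearedDefs
import Summits.QuantumFields.YangMills.Theorems.ForcedResponseSkewnessFemtoOfFBL6

/-!
# Skeleton «smeared-femto» for the deciding crux `ResponseLocalisation` (stmt-QuantumFields-24869; route
# `ForcedResponseSkewness` rev 5, UNCHANGED crux text; lead `ym-line-frs-p1` g4, 2026-08-28)

The crux's collar term `|respM(x)| = |Σ_{y,z} θv(s y) v(s z) κ₃(x,y,z)|` carries the NEAR partner already smeared against the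
fixed Schwartz source.  For the smeared near pair the g3 obstruction to femto-isation (the linear-background d-wave term
`g₀² B B ∂∂G(z−x)`, whose ABSOLUTE ball sum is `O(Φ²)` in a pinned unit) disappears: `Σ_z v(s z) ∂∂G(z−x) = Σ (∂∂v_s) G`
is `O(ρ²‖∂²v‖)` per site (no log), so the collar sum of that term is `O_v(1)·g₀²(β) → 0` — a `v`-dependent coupling threshold,
which the crux grants (`β₆` after `v`).  The running remainder `|B|²·2b₀ḡ⁴/|w|⁴` is an `L¹`-majorant controlled by `∫|v| ≤ 1`.

ResponseLocalisation ⇐ stub_fbl6Pinned             (E0′/FEMTO, the spine's `FBL6` along a pinned unit; SHARED with crux 24275)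
                     + stub_nearPairS              (AF/FEMTO, THE debt: `NearPairLawSSigR` — v-smeared near-pair conditional-covariance
                                                    law, two-slot bound `(κ + Σ_z |v| μ_β(z−x))/depth⁴`, thresholds after `v`)
                     + stub_smearedKernelOfFemto   (ANALYSIS, provable now, lead: `FBLPinnedSigR → NearPairLawSSigR → SmearedKernelSigR`,
                                                    the collar transfer of `contactKernel_of_femto` with the smeared near observable)
                     + stub_collarOfSmeared        (ANALYSIS, provable now, frs-p2: `SmearedKernelSigR →` crux body; geometry of
                                                    `stub_collarOfKernel` with the triangle inequality over the FAR index only)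
Statements: `Theorems/ForcedResponseSkewnessResponseLocalisationSmearedDefs.lean` (this line) and `…ResponseLocalisationDefs.lean`
(`FBL6PinnedSigR`, `FBLPinnedSigR`); `fblPinnedSigR_of_fbl6` is the tree's `Femto.fblPinnedSigR_of_fbl6` (p607908).
No summit is proved by any of this (leaf R2a `BalabanLadder.NT`, conditional on the residual 24873; the YM mass gap is NOT proved).
-/

set_option autoImplicit false

noncomputable section

namespace Summit.QuantumFields.YangMills.Cruxes.ResponseLocalisation.Smeared

open MeasureTheory Filter Topology
open Literature.MathematicalPhysics.QuantumFieldTheory Literature.MathematicalPhysics.QuantumLattice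
open Literature.Probability.LatticeModels
open Summit.QuantumFields.YangMills.Cruxes.OSLegsFromFemtoAndGap.DlrCollarTransfer
open Summit.QuantumFields.YangMills.Cruxes.ResponseLocalisation.Birth
open Summit.QuantumFields.YangMills.Cruxes.ResponseLocalisation.Femto (fblPinnedSigR_of_fbl6)
open Summit.QuantumFields.YangMills.Theses.ForcedResponseSkewness

/-! ## The registered stubs -/

/-- E0′/FEMTO engine stub (shared with crux 24275): the spine's plane-resolved frozen-boundary law along a pinned unit. -/
theorem stub_fbl6Pinned : FBL6PinnedSigR := by
  sorry

/-- AF/FEMTO stub (the line's debt): the v-smeared near-pair conditional-covariance law along a pinned unit. -/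
theorem stub_nearPairS : NearPairLawSSigR := by
  sorry

/-- ANALYSIS stub (lead): femto laws ⇒ torus-level smeared collar kernel. -/
theorem stub_smearedKernelOfFemto : SmearedKernelOfFemtoSigR := by
  sorry

/-- ANALYSIS stub (frs-p2): torus-level smeared collar kernel ⇒ crux body. -/
theorem stub_collarOfSmeared : CollarOfSmearedSigR := by
  sorry

/-- COMPOSITION (kernel-checked): the crux BY NAME. -/
theorem ResponseLocalisation_holds : ResponseLocalisation :=
  stub_collarOfSmeared (stub_smearedKernelOfFemto (fblPinnedSigR_of_fbl6 stub_fbl6Pinned) stub_nearPairS)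

end Summit.QuantumFields.YangMills.Cruxes.ResponseLocalisation.Smeared

end
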